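import Mathlib
import Summits.Ventures.PercRepro2.Defs
import Summits.Ventures.PercRepro2.Independence
import Summits.Ventures.PercRepro2.Harris
import Summits.Ventures.PercRepro2.Graph
import Summits.Ventures.PercRepro2.Exploration
import Summits.Ventures.PercRepro2.Events
import Summits.Ventures.PercRepro2.FourFunctions
import Summits.Ventures.PercRepro2.Induced
import Summits.Ventures.PercRepro2.Frontier
import Summits.Ventures.PercRepro2.ObsIndependence
import Summits.Ventures.PercRepro2.BHK
import Summits.Ventures.PercRepro2.BHKEvents
import Summits.Ventures.PercRepro2.OrderPreservation
import Summits.Ventures.PercRepro2.OrderPreservationDual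
import Summits.Ventures.PercRepro2.VdBKahn
import Summits.Ventures.PercRepro2.R4Defs
import Summits.Ventures.PercRepro2.R4Ladder
import Summits.Ventures.PercRepro2.R2PrimeThreeReduction
import Summits.Ventures.PercRepro2.Rungs

/-!
# The rung ladder (H4) ⟹ (H3′) ⟹ (H3): the three margins (blind cell PercRepro2, typer-1)

`proofs/LEAD-PROOFSHAPES.md` §8.11 ADDENDUM: with `U = C(a₂)`, `D = {a₁ ∉ U}`,

* `lam4_le_lam3`: `λ₄ = P(a₁ ↔ b, a₁ ∉ U) ≤ λ₃ = P(b ∈ U, a₁ ∉ U)` under the conn-order — this is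
  R10d (`orderPreserving_conn_avoid`, KN24 Lemma 3 (ii));
* `marginV1_nonneg`: `v₁ = P(o ∈ U | b ∈ U, a₁ ∉ U) − P(o ∈ U | a₁ ∉ U) ≥ 0` — same-cluster BHK
  (`bhk_same_cluster_events`, vdB–Kahn Thm 1.1);
* `marginV2_nonneg`: `v₂ = P(o ∈ U | a₁ ∉ U) − P(o ∈ U | a₁, b ∉ U) ≥ 0` — van den Berg–Kahn
  Thm 1.2 (`vdBK` with `A = {o}`, `X = {a₁, b}`, `Y = {a₁}`);

all three for NON-DEGENERATE instances (the conditioning events have positive probability; the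
typed rows use `x / 0 = 0`, so the implications are stated with the positivity hypotheses
`Nondegenerate`).  Hence `H3Prime_of_H4` and `H3_of_H3Prime`: the surviving ladder
`(H4) ⟹ (H3′) ⟹ (H3)` is a theorem, and a proof of (H4) (p1's target) proves all three.
-/

namespace Summit.Ventures.PercRepro2

section Ladder

variable {V : Type*} {E : Type*} [Fintype E] [DecidableEq E] [Fintype V] [DecidableEq V]
  {R : Type*} [Field R] [LinearOrder R] [IsStrictOrderedRing R]

/-- The conditioning events of the rungs have positive probability:
`P(a₁ ∉ U) > 0`, `λ₃ = P(b ∈ U, a₁ ∉ U) > 0`, `P(a₁, b ∉ U) > 0`. -/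
def Nondegenerate (p : E → R) (ends : E → Sym2 V) (a₁ a₂ b : V) : Prop :=
  0 < prob p (connEvent ends a₂ a₁)ᶜ ∧ 0 < lam3 p ends a₁ a₂ b ∧
    0 < prob p (avoidAll ends a₂ {a₁, b})

/-- `λ₄ ≤ λ₃` under the conn-order (R10d at the worse root `a₁`, avoiding `a₂`). -/
theorem lam4_le_lam3 (p : E → R) (hp : IsProbVec p) (ends : E → Sym2 V) {a₁ a₂ b : V}
    (h : ConnOrder p ends a₁ a₂ b) : lam4 p ends a₁ a₂ b ≤ lam3 p ends a₁ a₂ b := by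
  have := orderPreserving_conn_avoid p hp ends a₂ a₁ b a₂ h
  rw [connEvent_comm ends a₁ a₂] at this
  exact this

/-- `v₁ ≥ 0`: `P(o ∈ U, b ∈ U, a₁ ∉ U) · P(a₁ ∉ U) ≥ P(o ∈ U, a₁ ∉ U) · P(b ∈ U, a₁ ∉ U)`
(same-cluster BHK at the root `a₂`), in ratio form. -/
theorem marginV1_nonneg (p : E → R) (hp : IsProbVec p) (ends : E → Sym2 V) {o a₁ a₂ b : V}
    (hD : 0 < prob p (connEvent ends a₂ a₁)ᶜ) (h3 : 0 < lam3 p ends a₁ a₂ b) :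
    0 ≤ marginV1 p ends o a₁ a₂ b := by
  have key := bhk_same_cluster_events p hp ends a₂ a₁ (isUpperSet_mem_setOf o)
    (isUpperSet_mem_setOf b)
  rw [← connEvent_eq_clusterInEvent ends a₂ o, ← connEvent_eq_clusterInEvent ends a₂ b,
    connEvent_comm ends a₂ o] at key
  unfold marginV1 condOGivenB condO
  rw [sub_nonneg, div_le_div_iff₀ hD h3]
  unfold lam3
  exact key

/-- `v₂ ≥ 0`: `P(o ∈ U, a₁ ∉ U) · P(a₁, b ∉ U) ≥ P(o ∈ U, a₁, b ∉ U) · P(a₁ ∉ U)`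
(van den Berg–Kahn Thm 1.2 with `A = {o}`, `X = {a₁, b}`, `Y = {a₁}`), in ratio form. -/
theorem marginV2_nonneg (p : E → R) (hp : IsProbVec p) (ends : E → Sym2 V) {o a₁ a₂ b : V}
    (hD : 0 < prob p (connEvent ends a₂ a₁)ᶜ) (hAv : 0 < prob p (avoidAll ends a₂ {a₁, b})) :
    0 ≤ marginV2 p ends o a₁ a₂ b := by
  have key := vdBK p hp ends a₂ {o} ∅ {a₁, b} {a₁}
  have e1 : connAll ends a₂ ∅ = Set.univ := by
    ext ω; simp [connAll]
  have e2 : connAll ends a₂ {o} = connEvent ends o a₂ := by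
    ext ω; simp [connAll, connEvent_comm ends o a₂]
  have e3 : avoidAll ends a₂ {a₁} = (connEvent ends a₂ a₁)ᶜ := by
    ext ω; simp [avoidAll]
  have e4 : ({a₁, b} : Finset V) ∩ {a₁} = {a₁} := Finset.inter_eq_right.2 (by simp)
  have e5 : ({a₁, b} : Finset V) ∪ {a₁} = {a₁, b} := Finset.union_eq_left.2 (by simp)
  rw [e1, Finset.union_empty, e2, e4, e5, e3, Set.univ_inter] at key
  unfold marginV2 condO condOGivenAvoid
  rw [sub_nonneg, div_le_div_iff₀ hAv hD]
  linarith [key]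

/-- **(H4) ⟹ (H3′)** on non-degenerate instances: `λ₄ v₁ ≤ λ₃ v₁`. -/
theorem H3Prime_of_H4 (p : E → R) (hp : IsProbVec p) (ends : E → Sym2 V) {o a₁ a₂ b : V}
    (hnd : Nondegenerate p ends a₁ a₂ b) (h : H4 p ends o a₁ a₂ b) : H3Prime p ends o a₁ a₂ b := by
  intro horder
  have h4 := h horder
  have hle := lam4_le_lam3 p hp ends horder
  have hv1 := marginV1_nonneg p hp ends (o := o) hnd.1 hnd.2.1
  have := mul_le_mul_of_nonneg_right hle hv1
  nlinarith [h4, this]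

/-- **(H3′) ⟹ (H3)** on non-degenerate instances: `λ₄ v₂ ≤ λ₃ v₂`. -/
theorem H3_of_H3Prime (p : E → R) (hp : IsProbVec p) (ends : E → Sym2 V) {o a₁ a₂ b : V}
    (hnd : Nondegenerate p ends a₁ a₂ b) (h : H3Prime p ends o a₁ a₂ b) : H3 p ends o a₁ a₂ b := by
  intro horder
  have h3 := h horder
  have hle := lam4_le_lam3 p hp ends horder
  have hv2 := marginV2_nonneg p hp ends (o := o) hnd.1 hnd.2.2
  have := mul_le_mul_of_nonneg_right hle hv2
  nlinarith [h3, this]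

/-- **(H4) ⟹ (H3)** on non-degenerate instances. -/
theorem H3_of_H4 (p : E → R) (hp : IsProbVec p) (ends : E → Sym2 V) {o a₁ a₂ b : V}
    (hnd : Nondegenerate p ends a₁ a₂ b) (h : H4 p ends o a₁ a₂ b) : H3 p ends o a₁ a₂ b :=
  H3_of_H3Prime p hp ends hnd (H3Prime_of_H4 p hp ends hnd h)

omit [Fintype V] in
/-- The BHK margin is nonnegative on non-degenerate instances:
`T1 = λ₄ · (P(o ∈ U | a₁, b ∉ U) − P(o ∈ U | a₁ ↔ b, a₁ ∉ U)) ≥ 0` (p1's `t1_nonneg` in the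
margin vocabulary is the cleared form; this is the ratio form). -/
theorem marginT1_nonneg_of_cleared (p : E → R) (hp : IsProbVec p) (ends : E → Sym2 V)
    {o a₁ a₂ b : V} (hAv : 0 < prob p (avoidAll ends a₂ {a₁, b})) (h4 : 0 < lam4 p ends a₁ a₂ b)
    (hcl : prob p (connEvent ends o a₂ ∩ connEvent ends a₁ b ∩ (connEvent ends a₂ a₁)ᶜ) *
        prob p (avoidAll ends a₂ {a₁, b}) ≤
      prob p (connEvent ends o a₂ ∩ avoidAll ends a₂ {a₁, b}) * lam4 p ends a₁ a₂ b) :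
    0 ≤ marginT1 p ends o a₁ a₂ b := by
  unfold marginT1 condOGivenAvoid condOGivenConn
  refine mul_nonneg (prob_nonneg hp _) ?_
  rw [sub_nonneg, div_le_div_iff₀ h4 hAv]
  exact hcl

end Ladder

end Summit.Ventures.PercRepro2
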